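import Summits.QuantumFields.QCD.Theses.AdaptiveBlockFermions

/-!
# Refutation of `AdaptiveBlockFermions.AdaptiveCoarseSystem` (item stmt-QuantumFields-9494)

`theorem AdaptiveBlockFermionsAdaptiveCoarseSystem_refuted : ¬ AdaptiveCoarseSystem`.

## The witness (one-site torus `L = 1`, block side `b ≫ 1`, `m = 0`, `r = 1`)

Gauge field on the four links of the `L = 1` torus: `U₀ = U₁ = U₂ = R := diag(-1,-1,1)` and
`U₃ = G := [[c,0,s],[0,1,0],[-s,0,c]]` (a rotation in the `(0,2)` colour plane, `c² + s² = 1`,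
`c = 1 - ε`).  For this field the tree's `wilsonDirac` acts by (colour `a`, spin `σ`, `σ̄` the
`γ₃ = σˣ ⊗ 1` partner of `σ`, i.e. `0 ↔ 2`, `1 ↔ 3`):
`(Dg)(0,σ) = (7-c) g(0,σ) + s g(2,σ̄)`, `(Dg)(1,σ) = 6 g(1,σ)`, `(Dg)(2,σ) = (1-c) g(2,σ) - s g(0,σ̄)`
(hypothesis `hmv` in the proof).  Consequences:
* every CHIRAL vector (`γ₅ = diag(1,1,-1,-1)`-eigenvector, clause (b)) has `‖Dg‖² ≥ 2ε‖g‖²`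
  (`hrough`; `(1-c)² + s² = 2ε`), whereas
* the non-chiral vector `f₀ = (-s, 0, 7-c) ⊗ (1,0,1,0)` has `‖Df₀‖² = 128 ε²`, `‖f₀‖² = 72 + 28ε`.
Given the claimed constants take `b := ⌈2Cs²Cw/3 + 3/(4Cw)⌉₊ + 2` and `ε := 3/(4·Cw·b)`.  Then
`2εb² > Cs²`, so clause (e) (`b²‖Dg‖² ≤ Cs²‖g‖²` on generators) and `hrough` force every
generator to vanish; clause (f) then applies to `f₀` and reads `72 + 28ε ≤ 128 (Cw b ε)² = 72`.
Only clauses (b) [chirality], (e) [D-smoothness] and (f) [complementary coercivity] are used;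
`m = 0` lies in the resolution window for every `cres > 0`.

## Why (mechanism, for the provers and the planner)
`D_W` is non-normal.  A chirality-split generator family spans a `γ₅`-invariant `W`; since
`D_W† = γ₅ D_W γ₅`, D-smoothness of `W` is automatically `D_W†`-smoothness.  But on this (weak,
lattice-scale) field the low RIGHT singular vector of `D_W` (`σ ≈ (4/3)ε`) is `D_W†`-low only at
level `√(2ε)`: no `γ₅`-invariant D-smooth space can capture it, and (f) fails on it.
-/

namespace Summit.QuantumFields.QCD.Theorems

open Literature.MathematicalPhysics.QuantumLattice Literature.MathematicalPhysics.QuantumFieldTheory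
open Literature.Probability.LatticeModels Matrix

set_option maxHeartbeats 1600000 in
/-- Refutes `AdaptiveBlockFermions.AdaptiveCoarseSystem` [refuted-substantive]: there are NO
universal constants for which every SU(3) field admits a chirality-split (b), D-smooth (e),
complementarily coercive (f) generator family.  Witness: the one-site torus `L = 1` with links
`U₀=U₁=U₂ = diag(-1,-1,1)`, `U₃ =` rotation by `arccos(1-ε)` in the `(0,2)` colour plane, `m = 0`,
block side `b = ⌈2Cs²Cw/3 + 3/(4Cw)⌉₊ + 2`, `ε = 3/(4 Cw b)`: chiral vectors have
`‖Dg‖² ≥ 2ε‖g‖² > (Cs/b)²‖g‖²`, so (e) empties the generator family, and then (f) fails on the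
non-chiral low singular vector `f₀` (`‖Df₀‖²/‖f₀‖² = 128ε²/(72+28ε) < 1/(Cw b)²`).  Mechanism:
`D_W† = γ₅ D_W γ₅`, so a `γ₅`-invariant D-smooth `W` is `D_W†`-smooth, while low right-singular
vectors of the non-normal `D_W` are `D_W†`-low only at level `√ε` versus `ε`.  No cheap repair:
dropping (b) (or any `γ₅`-compatibility of `W`) removes the closure property
`CoarseActionGammaFive` the bridge iterates; the natural survivor is a Petrov–Galerkin pair
(NON-chiral trial space `W` of low right-singular vectors, test space `γ₅W ≠ W`), a different
statement (for a chirality-split `W` one has `γ₅W = W`); excluding `b > L` does not obviously help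
either (the
constant-link lift of the witness to even tori `L = 2bj` is gauge-equivalent to a weak staggered
field with the same local algebra in the colour sector `{0,2}`; momentum scan of
`λ_min((D†D+DD†)/2)` over the Brillouin zone: compute job j005472 attached to the item).
barrier-candidate: chirality-compatible coarse spaces cannot be two-sided smooth for a
non-normal `D_W` (right/left low singular subspaces decohere at rate `√σ` versus `σ`). [folklore] -/
theorem AdaptiveBlockFermionsAdaptiveCoarseSystem_refuted :
    ¬ Summit.QuantumFields.QCD.Theses.AdaptiveBlockFermions.AdaptiveCoarseSystem := by
  rintro ⟨c₀, cres, c₁, Cs, Cw, θ, Θ, -, hcres, -, hCs, hCw, -, -, N₀, N₁, H⟩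
  /- (1) the block side `b` and the rotation defect `ε` -/
  set K : ℝ := 2 * Cs ^ 2 * Cw / 3 + 3 / (4 * Cw) with hK
  have hK1 : (0 : ℝ) ≤ 2 * Cs ^ 2 * Cw / 3 := by positivity
  have hK2 : (0 : ℝ) < 3 / (4 * Cw) := by positivity
  set b : ℕ := ⌈K⌉₊ + 2 with hb
  have hbK : K + 2 ≤ (b : ℝ) := by
    have := Nat.le_ceil K
    simp only [hb, Nat.cast_add, Nat.cast_ofNat]
    linarith
  have hb2 : 2 ≤ b := by omega
  have hbpos : (0 : ℝ) < b := by linarith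
  have hb_gt1 : 2 * Cs ^ 2 * Cw / 3 < b := by linarith
  have hb_gt2 : 3 / (4 * Cw) < b := by linarith
  set ε : ℝ := 3 / (4 * Cw * b) with hε
  have hε0 : 0 < ε := by positivity
  have hεkey : Cw * b * ε = 3 / 4 := by
    rw [hε]; field_simp
  have hε1 : ε < 1 := by
    have h4 : 3 < 4 * Cw * (b : ℝ) := by
      have := (div_lt_iff₀ (by positivity : (0 : ℝ) < 4 * Cw)).mp hb_gt2
      linarith
    rw [hε, div_lt_one (by positivity)]
    exact h4
  have hεCs : Cs ^ 2 < 2 * ε * (b : ℝ) ^ 2 := by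
    have h3 : 2 * ε * (b : ℝ) ^ 2 = 3 * b / (2 * Cw) := by
      rw [hε]; field_simp; ring
    rw [h3, lt_div_iff₀ (by positivity)]
    nlinarith
  /- (2) the rotation: `c = 1 - ε`, `s = √(1 - c²)` -/
  set c : ℝ := 1 - ε with hc
  have hc2 : 0 ≤ 1 - c ^ 2 := by nlinarith
  set s : ℝ := Real.sqrt (1 - c ^ 2) with hs
  have hcs : c ^ 2 + s ^ 2 = 1 := by
    rw [hs, Real.sq_sqrt hc2]; ring
  have hC : (c : ℂ) ^ 2 + (s : ℂ) ^ 2 = 1 := by exact_mod_cast hcs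
  have hC' : (s : ℂ) ^ 2 = 1 - (c : ℂ) ^ 2 := by linear_combination hC
  have hs2 : s * s = 1 - c ^ 2 := by nlinarith
  have hc1 : c ≤ 1 := by linarith
  have hcm : -1 ≤ c := by linarith
  /- (3) the two SU(3) matrices -/
  have hR : (!![-1, 0, 0; 0, -1, 0; 0, 0, 1] : Matrix (Fin 3) (Fin 3) ℂ) ∈
      Matrix.specialUnitaryGroup (Fin 3) ℂ := by
    rw [Matrix.mem_specialUnitaryGroup_iff, Matrix.mem_unitaryGroup_iff]
    constructor
    · ext i j
      fin_cases i <;> fin_cases j <;> simp [Matrix.mul_apply, Fin.sum_univ_three, Matrix.star_apply]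
    · simp [Matrix.det_fin_three]
  have hG : (!![(c : ℂ), 0, (s : ℂ); 0, 1, 0; -(s : ℂ), 0, (c : ℂ)] : Matrix (Fin 3) (Fin 3) ℂ) ∈
      Matrix.specialUnitaryGroup (Fin 3) ℂ := by
    rw [Matrix.mem_specialUnitaryGroup_iff, Matrix.mem_unitaryGroup_iff]
    constructor
    · ext i j
      fin_cases i <;> fin_cases j <;>
        simp [Matrix.mul_apply, Fin.sum_univ_three, Matrix.star_apply] <;>
        (first | linear_combination hC | ring1)
    · simp [Matrix.det_fin_three]
      linear_combination hC
  /- (4) the witness field on the one-site torus and the closed form of its Wilson–Dirac operator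
     (`![2, 3, 0, 1]` is the `γ₃ = σˣ ⊗ 1` partner map on spin indices) -/
  obtain ⟨U, hmv⟩ : ∃ U : GaugeConfig 4 1 (Matrix.specialUnitaryGroup (Fin 3) ℂ),
      ∀ (g : TorusSite 4 1 × Fin 3 × Fin 4 → ℂ) (x : TorusSite 4 1) (a : Fin 3) (σ : Fin 4),
        (wilsonDirac (fundamentalRep (Fin 3)) U 0 1 *ᵥ g) (x, a, σ) =
          ![(7 - (c : ℂ)) * g (x, 0, σ) + (s : ℂ) * g (x, 2, (![2, 3, 0, 1] : Fin 4 → Fin 4) σ),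
            6 * g (x, 1, σ),
            (1 - (c : ℂ)) * g (x, 2, σ) - (s : ℂ) * g (x, 0, (![2, 3, 0, 1] : Fin 4 → Fin 4) σ)] a :=
    ⟨fun e => if e.2 = 3 then ⟨_, hG⟩ else ⟨_, hR⟩, by
      intro g x a σ
      simp only [Matrix.mulVec, dotProduct, Fintype.sum_prod_type]
      rw [Fintype.sum_subsingleton _ x]
      fin_cases a <;> fin_cases σ <;>
        simp [wilsonDirac, Matrix.of_apply, Fin.sum_univ_four, Fin.sum_univ_three, euclideanGamma,
          spinHalfPauli, Matrix.kroneckerMap_apply, finProdFinEquiv, Fin.divNat, Fin.modNat,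
          ← Matrix.star_eq_inv, Matrix.specialUnitaryGroup.coe_star, Matrix.star_apply,
          eq_iff_true_of_subsingleton] <;>
        first | ring1 | norm_num⟩
  set D := wilsonDirac (fundamentalRep (Fin 3)) U 0 1 with hD
  /- (5) squared norms as explicit sums over colour × spin -/
  have hre : ∀ v : TorusSite 4 1 × Fin 3 × Fin 4 → ℂ,
      (star v ⬝ᵥ v).re = ∑ a : Fin 3, ∑ σ : Fin 4, Complex.normSq (v (default, a, σ)) := by
    intro v
    have h1 : (star v ⬝ᵥ v).re = ∑ p, Complex.normSq (v p) := by
      simp [dotProduct, ← Complex.normSq_eq_conj_mul_self]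
    rw [h1]
    simp only [Fintype.sum_prod_type]
    rw [Fintype.sum_unique]
  have hnn : ∀ v : TorusSite 4 1 × Fin 3 × Fin 4 → ℂ, 0 ≤ (star v ⬝ᵥ v).re := by
    intro v; rw [hre]
    exact Finset.sum_nonneg fun a _ => Finset.sum_nonneg fun σ _ => Complex.normSq_nonneg _
  have n7 : Complex.normSq (7 - (c : ℂ)) = (7 - c) ^ 2 := by
    rw [show (7 : ℂ) - (c : ℂ) = ((7 - c : ℝ) : ℂ) by push_cast; ring, Complex.normSq_ofReal]; ring
  have n1 : Complex.normSq (1 - (c : ℂ)) = (1 - c) ^ 2 := by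
    rw [show (1 : ℂ) - (c : ℂ) = ((1 - c : ℝ) : ℂ) by push_cast; ring, Complex.normSq_ofReal]; ring
  have n8 : Complex.normSq (8 - 8 * (c : ℂ)) = (8 - 8 * c) ^ 2 := by
    rw [show (8 : ℂ) - 8 * (c : ℂ) = ((8 - 8 * c : ℝ) : ℂ) by push_cast; ring, Complex.normSq_ofReal]
    ring
  have n6 : Complex.normSq (6 : ℂ) = 36 := by
    rw [show (6 : ℂ) = ((6 : ℝ) : ℂ) by norm_num, Complex.normSq_ofReal]; norm_num
  /- (6) CHIRAL ROUGHNESS: every chiral vector has `‖Dg‖² ≥ 2(1-c)‖g‖²` -/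
  have hrough : ∀ g : TorusSite 4 1 × Fin 3 × Fin 4 → ℂ,
      ((∀ p, g p ≠ 0 → (p.2.2 : ℕ) < 2) ∨ (∀ p, g p ≠ 0 → 2 ≤ (p.2.2 : ℕ))) →
        2 * (1 - c) * (star g ⬝ᵥ g).re ≤ (star (D *ᵥ g) ⬝ᵥ (D *ᵥ g)).re := by
    intro g hg
    rw [hre, hre]
    simp only [Fin.sum_univ_three, Fin.sum_univ_four, hmv]
    have n00 := Complex.normSq_nonneg (g (default, 0, 0))
    have n01 := Complex.normSq_nonneg (g (default, 0, 1))
    have n02 := Complex.normSq_nonneg (g (default, 0, 2))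
    have n03 := Complex.normSq_nonneg (g (default, 0, 3))
    have n10 := Complex.normSq_nonneg (g (default, 1, 0))
    have n11 := Complex.normSq_nonneg (g (default, 1, 1))
    have n12 := Complex.normSq_nonneg (g (default, 1, 2))
    have n13 := Complex.normSq_nonneg (g (default, 1, 3))
    have n20 := Complex.normSq_nonneg (g (default, 2, 0))
    have n21 := Complex.normSq_nonneg (g (default, 2, 1))
    have n22 := Complex.normSq_nonneg (g (default, 2, 2))
    have n23 := Complex.normSq_nonneg (g (default, 2, 3))
    rcases hg with hg | hg
    · have hz : ∀ a : Fin 3, g (default, a, 2) = 0 ∧ g (default, a, 3) = 0 := by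
        intro a
        constructor <;> by_contra hne <;> exact absurd (hg _ hne) (by norm_num)
      simp only [Matrix.cons_val_zero, Matrix.cons_val_one, Matrix.head_cons,
        Matrix.cons_val_two, Matrix.tail_cons, Matrix.cons_val_three,
        (hz 0).1, (hz 0).2, (hz 1).1, (hz 1).2, (hz 2).1, (hz 2).2,
        mul_zero, add_zero, zero_add, sub_zero, zero_sub, map_zero, Complex.normSq_neg,
        Complex.normSq_mul, Complex.normSq_ofReal, n7, n1, n6]
      rw [hs2]
      nlinarith [mul_nonneg (by linarith : (0:ℝ) ≤ 48 - 12 * c) n00,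
        mul_nonneg (by linarith : (0:ℝ) ≤ 48 - 12 * c) n01,
        mul_nonneg (by linarith : (0:ℝ) ≤ 34 + 2 * c) n10,
        mul_nonneg (by linarith : (0:ℝ) ≤ 34 + 2 * c) n11]
    · have hz : ∀ a : Fin 3, g (default, a, 0) = 0 ∧ g (default, a, 1) = 0 := by
        intro a
        constructor <;> by_contra hne <;> exact absurd (hg _ hne) (by norm_num)
      simp only [Matrix.cons_val_zero, Matrix.cons_val_one, Matrix.head_cons,
        Matrix.cons_val_two, Matrix.tail_cons, Matrix.cons_val_three,
        (hz 0).1, (hz 0).2, (hz 1).1, (hz 1).2, (hz 2).1, (hz 2).2,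
        mul_zero, add_zero, zero_add, sub_zero, zero_sub, map_zero, Complex.normSq_neg,
        Complex.normSq_mul, Complex.normSq_ofReal, n7, n1, n6]
      rw [hs2]
      nlinarith [mul_nonneg (by linarith : (0:ℝ) ≤ 48 - 12 * c) n02,
        mul_nonneg (by linarith : (0:ℝ) ≤ 48 - 12 * c) n03,
        mul_nonneg (by linarith : (0:ℝ) ≤ 34 + 2 * c) n12,
        mul_nonneg (by linarith : (0:ℝ) ≤ 34 + 2 * c) n13]
  /- (7) the non-chiral low right-singular vector `f₀ = (-s, 0, 7-c) ⊗ (1,0,1,0)` -/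
  set f0 : TorusSite 4 1 × Fin 3 × Fin 4 → ℂ := fun p =>
    ![-(s : ℂ) * (![1, 0, 1, 0] : Fin 4 → ℂ) p.2.2, 0,
      (7 - (c : ℂ)) * (![1, 0, 1, 0] : Fin 4 → ℂ) p.2.2] p.2.1 with hf0
  have hDf0 : D *ᵥ f0 = fun p => ![0, 0, (8 - 8 * (c : ℂ)) * (![1, 0, 1, 0] : Fin 4 → ℂ) p.2.2] p.2.1 := by
    funext ⟨x, a, σ⟩
    rw [hmv]
    fin_cases a <;> fin_cases σ <;> simp [hf0] <;> first | ring1 | linear_combination hC'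
  have hnf0 : (star f0 ⬝ᵥ f0).re = 2 * (50 - 14 * c) := by
    rw [hre]
    simp only [Fin.sum_univ_three, Fin.sum_univ_four, hf0, Matrix.cons_val_zero, Matrix.cons_val_one,
      Matrix.head_cons, Matrix.cons_val_two, Matrix.tail_cons, Matrix.cons_val_three,
      mul_zero, mul_one, map_zero, Complex.normSq_neg, Complex.normSq_ofReal, n7]
    rw [hs2]; ring
  have hnDf0 : (star (D *ᵥ f0) ⬝ᵥ (D *ᵥ f0)).re = 128 * (1 - c) ^ 2 := by
    rw [hDf0, hre]
    simp only [Fin.sum_univ_three, Fin.sum_univ_four, Matrix.cons_val_zero, Matrix.cons_val_one,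
      Matrix.head_cons, Matrix.cons_val_two, Matrix.tail_cons, Matrix.cons_val_three,
      mul_zero, mul_one, map_zero, n8]
    ring
  /- (8) instantiate the claimed coarse system at `L = 1`, block side `b`, the witness field, `m = 0` -/
  have key := H 1 b hb2 U 0
    (by have : 0 ≤ cres / (b : ℝ) ^ 2 := by positivity
        linarith)
    (by norm_num)
  obtain ⟨gens, -, hchir, -, -, hsm, hco, -⟩ := key
  rw [← hD] at hsm hco
  /- Step A: chirality (b) + D-smoothness (e) + chiral roughness ⟹ every generator vanishes -/
  have hzero : ∀ g ∈ gens, g = 0 := by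
    intro g hg
    have h1 := hsm g (Submodule.subset_span hg)
    have h2 := hrough g (hchir g hg)
    have h2' : 2 * ε * (star g ⬝ᵥ g).re ≤ (star (D *ᵥ g) ⬝ᵥ (D *ᵥ g)).re := by
      have : 2 * (1 - c) = 2 * ε := by rw [hc]; ring
      rw [← this]; exact h2
    have h4 := mul_le_mul_of_nonneg_left h2' (sq_nonneg (b : ℝ))
    have h5 : (2 * ε * (b : ℝ) ^ 2 - Cs ^ 2) * (star g ⬝ᵥ g).re ≤ 0 := by nlinarith
    have hYle : (star g ⬝ᵥ g).re ≤ 0 := by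
      by_contra hpos
      push Not at hpos
      have := mul_pos (sub_pos.mpr hεCs) hpos
      linarith
    have hY : (star g ⬝ᵥ g).re = 0 := le_antisymm hYle (hnn g)
    have hY' : (star g ⬝ᵥ g).re = ∑ p, Complex.normSq (g p) := by
      simp [dotProduct, ← Complex.normSq_eq_conj_mul_self]
    rw [hY'] at hY
    have hall := (Finset.sum_eq_zero_iff_of_nonneg (fun p _ => Complex.normSq_nonneg (g p))).mp hY
    funext p
    exact Complex.normSq_eq_zero.mp (hall p (Finset.mem_univ p))
  /- Step B: complementary coercivity (f) on `f₀` (all its constraints are void) is false -/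
  have h3 := hco f0 (fun g hg => by rw [hzero g hg]; simp)
  rw [hnf0, hnDf0] at h3
  have h1c : 1 - c = ε := by rw [hc]; ring
  have h72 : Cw ^ 2 * (b : ℝ) ^ 2 * (128 * (1 - c) ^ 2) = 72 := by
    rw [h1c, show Cw ^ 2 * (b : ℝ) ^ 2 * (128 * ε ^ 2) = 128 * (Cw * b * ε) ^ 2 by ring, hεkey]
    norm_num
  nlinarith

end Summit.QuantumFields.QCD.Theorems
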